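import Summits.BirchSwinnertonDyer.BirchSwinnertonDyer.Theorems.KolyvaginRankRigidityAtTwoStartFrameNearCoreHolds
import Summits.BirchSwinnertonDyer.BirchSwinnertonDyer.Theorems.KolyvaginRankRigidityAtTwoWalkEngineAdapter
import HarnessLib

/-!
# Crux U1 `KolyvaginBoundedDefectAtTwo` (stmt-BirchSwinnertonDyer-28083), LINE 17 `kolyvagin_swap` —
# START (ii) · THE START SHAPE `StartShapeAtTwo` (pen v7.6–v7.8 support stub `stub_startShapeAtTwo`, price S) PROVED:
# at `e = 1` the signed shape `Sh(t, a₀)` holds for both signs, `a₀ = J + 1 + d` uniform in the level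

Width seat `bsd-line-krr2-p2` g18 (ONE READER on LINE 17); `--supports stmt-BirchSwinnertonDyer-28083` (helper). HONEST FRAMING:
START is a support stub of the pen's (unregistered) v7.6+ typing of LINE 17, not a registered stub of the line of record v7.2r; nothing
here proves SWα, U1, a rung or BSD. BSD is NOT proved.

## Statement
`startShapeAtTwo` = the pen's `StartShapeAtTwo` (v7.7 `kolyvagin_swap_v77.lean` 55dfebd9 l.415–418 = v7.8) BYTE-FOR-BYTE with its one
defined term `OppShape W K ι τ M 1 u a₀ t` UNFOLDED (the v7.x definitions are not an importable module; with `OppShape` in scope the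
skeleton's stub closes by `exact startShapeAtTwo` through definitional unfolding): on U1's habitat, for `τ ≠ 1` there is `a₀` such that
for every level `M ≥ 1` and sign `u` the `(−u)`-part of `H_{𝓕(1)} = Sel` has shape `Sh(t, a₀)` for some rank `t` — exact
`(−u)`-eigenclasses `g₁ … g_t ∈ H_{𝓕(1)}(K, E[2^M])` that are NEARLY FREE modulo phantoms on `Γ_{K(E[2^(M+1)])}`
(`Σ bᵢ gᵢ ≡ 0 ⟹ 2^(M−a₀) ∣ bᵢ`) and SPAN every exact `(−u)`-class up to `2^(a₀)` modulo phantoms.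

## Proof
The tree's START FRAME `RegularWalk.startFrameAtTwo_holds` (g16/gk2-p5: an `m`-frame `g` of `τ`-eigenclasses of signs `sg`, spanning
`2^J · Sel` modulo phantoms, nearly independent up to `2^d`, both uniform in the level) RESTRICTED TO ONE SIGN `ε = −u`: the sub-family
`{gᵢ : sgᵢ = ε}` (re-indexed by `Fin t` through `Finset.orderIsoOfFin`) inherits near-freeness (extend coefficients by zero), and spans the
exact `ε`-classes with one more bit: for `2^J y ≡ Σ bᵢ gᵢ`, symmetrising with `1 + ε τ` (phantoms are `τ`-stable:
`WalkEngineAdapter.forall_h1Eval_conjAct_eq`) gives `2^(J+1) y ≡ Σ_{sgᵢ = ε} 2bᵢ gᵢ` since `1 + ε sgᵢ ∈ {0, 2}`; `a₀ = J + 1 + d`.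
References (locators only; no cited FACT is declared): [cite: Greenberg1999, §1–2] [cite: GrossLMS1991, §5, §9] [cite: MazurRubin2004, §4.1].
Design: no definitions; `K : Type`; axioms `propext`, `Classical.choice`, `Quot.sound`.
-/

set_option autoImplicit false
-- the Theorems namespace of this sub repeats the summit name by design (D-0017 nested layout)
set_option linter.dupNamespace false

noncomputable section

open scoped Classical
open Function NumberField IsDedekindDomain WeierstrassCurve Field Finset
open Literature.NumberTheory.EllipticCurves Literature.NumberTheory.EllipticCurves.Jetchev2008
open Literature.NumberTheory.EllipticCurves.KolyvaginPairing
open Literature.NumberTheory.GaloisRepresentations Literature.NumberTheory.GaloisCohomology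
open Literature.NumberTheory.Automorphic Literature.NumberTheory
open Summit.BirchSwinnertonDyer.Rank1Residual

namespace Summit.BirchSwinnertonDyer.BirchSwinnertonDyer.Theorems.KolyvaginAtTwo.RegularWalk

/-- Re-indexing a sum over a finset `S ⊆ Fin m` by `Fin S.card` through `Finset.orderIsoOfFin`. [folklore] -/
theorem sum_eq_sum_orderIsoOfFin {m : ℕ} {G : Type*} [AddCommMonoid G] (S : Finset (Fin m)) (f : Fin m → G) :
    ∑ i ∈ S, f i = ∑ j : Fin S.card, f ((S.orderIsoOfFin rfl j : S) : Fin m) := by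
  rw [← Finset.sum_coe_sort S f]
  exact (Equiv.sum_comp (S.orderIsoOfFin rfl).toEquiv (fun x : S ↦ f (x : Fin m))).symm

/-- Extension by zero of coefficients on a sub-family. [folklore] -/
theorem sum_extendByZero_smul {m : ℕ} {G : Type*} [AddCommGroup G] (S : Finset (Fin m)) (g : Fin m → G)
    (b' : Fin S.card → ℤ) :
    ∑ i, (if h : i ∈ S then b' ((S.orderIsoOfFin rfl).symm ⟨i, h⟩) else 0) • g i =
      ∑ j : Fin S.card, b' j • g ((S.orderIsoOfFin rfl j : S) : Fin m) := by
  classical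
  have h1 : ∑ i, (if h : i ∈ S then b' ((S.orderIsoOfFin rfl).symm ⟨i, h⟩) else 0) • g i =
      ∑ i ∈ S, (if h : i ∈ S then b' ((S.orderIsoOfFin rfl).symm ⟨i, h⟩) else 0) • g i := by
    rw [← Finset.sum_filter_add_sum_filter_not Finset.univ (fun i ↦ i ∈ S)]
    have hzero : ∑ i ∈ Finset.univ.filter (fun i ↦ i ∉ S),
        (if h : i ∈ S then b' ((S.orderIsoOfFin rfl).symm ⟨i, h⟩) else 0) • g i = 0 :=
      Finset.sum_eq_zero fun i hi ↦ by rw [dif_neg (Finset.mem_filter.mp hi).2, zero_smul]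
    rw [hzero, add_zero, Finset.filter_mem_eq_inter, Finset.univ_inter]
  rw [h1, sum_eq_sum_orderIsoOfFin S]
  refine Finset.sum_congr rfl fun j _ ↦ ?_
  rw [dif_pos (S.orderIsoOfFin rfl j).2]
  congr 2
  rw [OrderIso.symm_apply_eq]

/-- The symmetrisation identity of the start frame restricted to one sign. [folklore] -/
theorem symmetrised_frame_identity {m : ℕ} {G : Type*} [AddCommGroup G] (S : Finset (Fin m)) (g : Fin m → G)
    (sg b : Fin m → ℤ) {ε : ℤ} (hεε : ε * ε = 1) (hS : ∀ i, i ∈ S ↔ sg i = ε) (hsg : ∀ i, sg i = 1 ∨ sg i = -1)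
    (J d : ℕ) (y : G) :
    ((2 : ℤ) ^ (J + 1 + d)) • y - ∑ i ∈ S, ((2 : ℤ) ^ (d + 1) * b i) • g i =
      ((2 : ℤ) ^ d) • ((((2 : ℤ) ^ J) • y - ∑ i, b i • g i) +
        ε • (((2 : ℤ) ^ J) • (ε • y) - ∑ i, b i • (sg i • g i))) := by
  classical
  -- per-index coefficients
  have hcoef : ∀ i, b i + ε * (b i * sg i) = if i ∈ S then 2 * b i else 0 := fun i ↦ by
    by_cases hi : i ∈ S
    · rw [if_pos hi, (hS i).mp hi, mul_comm (b i) ε, ← mul_assoc, hεε, one_mul, two_mul]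
    · rw [if_neg hi]
      have hne : sg i ≠ ε := fun h'' ↦ hi ((hS i).mpr h'')
      have hε : ε = 1 ∨ ε = -1 := by
        rcases hsg i with h | h
        · rcases Int.eq_one_or_neg_one_of_mul_eq_one' hεε with h' | h' <;> simp [h']
        · rcases Int.eq_one_or_neg_one_of_mul_eq_one' hεε with h' | h' <;> simp [h']
      have hsi : sg i = -ε := by rcases hsg i with h | h <;> rcases hε with h' | h' <;> omega
      rw [hsi, mul_neg, mul_neg, mul_comm (b i) ε, ← mul_assoc, hεε, one_mul, add_neg_cancel]
  -- Step A
  have hA : ∑ i, b i • g i + ε • ∑ i, b i • (sg i • g i) = ∑ i ∈ S, (2 * b i) • g i := by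
    rw [Finset.smul_sum, ← Finset.sum_add_distrib]
    have h3 : ∀ i, b i • g i + ε • (b i • (sg i • g i)) = (if i ∈ S then 2 * b i else 0) • g i := fun i ↦ by
      rw [smul_smul, smul_smul, ← add_smul, ← hcoef i, mul_assoc]
    rw [Finset.sum_congr rfl fun i _ ↦ h3 i]
    rw [← Finset.sum_filter_add_sum_filter_not Finset.univ (fun i ↦ i ∈ S)]
    have hz : ∑ i ∈ Finset.univ.filter (fun i ↦ i ∉ S), (if i ∈ S then 2 * b i else 0) • g i = 0 :=
      Finset.sum_eq_zero fun i hi ↦ by rw [if_neg (Finset.mem_filter.mp hi).2, zero_smul]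
    rw [hz, add_zero, Finset.filter_mem_eq_inter, Finset.univ_inter]
    exact Finset.sum_congr rfl fun i hi ↦ by rw [if_pos hi]
  -- Step B
  have hC : ∑ i ∈ S, ((2 : ℤ) ^ (d + 1) * b i) • g i = ((2 : ℤ) ^ d) • ∑ i ∈ S, (2 * b i) • g i := by
    rw [Finset.smul_sum]
    exact Finset.sum_congr rfl fun i _ ↦ by rw [smul_smul, pow_succ, mul_assoc]
  have hy2 : ε • (((2 : ℤ) ^ J) • (ε • y)) = ((2 : ℤ) ^ J) • y := by
    rw [smul_smul, smul_smul, mul_comm ε, mul_assoc, hεε, mul_one]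
  rw [hC, ← hA, smul_sub ε, hy2]
  module

set_option maxHeartbeats 800000 in
/-- **START (ii) `StartShapeAtTwo` (pen v7.6–v7.8, VERBATIM with `OppShape … 1 u a₀ t` unfolded).** See the module docstring.
[cite: Greenberg1999, §1–2] [cite: GrossLMS1991, §5] [cite: MazurRubin2004, §4.1] -/
theorem startShapeAtTwo :
    ∀ (W : WeierstrassCurve ℚ) [W.IsElliptic] [W.IsGloballyMinimal], ¬ W.HasCM → (Literature.NumberTheory.EllipticCurves.Rank1Residual.GoodOrd W 2 ∨ Literature.NumberTheory.EllipticCurves.Rank1Residual.Mult W 2) → (∀ m : ℕ, W.HasSurjectiveModNGaloisRep (2 ^ m : ℕ)) → ∀ (K : Type) [Field K] [NumberField K], Literature.NumberTheory.EllipticCurves.IsImaginaryQuadratic K → ∀ [NeZero (W.conductorNorm ℤ)], Literature.NumberTheory.EllipticCurves.SatisfiesHeegnerHypothesis (W.conductorNorm ℤ) K → Odd (NumberField.discr K) → NumberField.discr K ≠ -3 → AddSubgroup.torsionBy (W.baseChange K).toAffine.Point (2 : ℤ) = ⊥ → Literature.NumberTheory.EllipticCurves.SatisfiesHeegnerHypothesis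 2 K → ∀ (Dt : Literature.NumberTheory.EllipticCurves.ModularForms.ModularParametrizationData W (W.conductorNorm ℤ)) (β : ℤ) (ι : K →+* ℂ) [∀ k : ℕ, NumberField (ringClassField K ι k)], (4 * (W.conductorNorm ℤ : ℤ)) ∣ β ^ 2 - NumberField.discr K →
    ∀ (τ : K ≃ₐ[ℚ] K), τ ≠ 1 →
      ∃ a₀ : ℕ, ∀ (M : ℕ) (u : ℤ), 1 ≤ M → (u = 1 ∨ u = -1) → ∃ t : ℕ,
        ∃ (g : Fin t → galH1Torsion (W.baseChange K) ((2 ^ M : ℕ) : ℤ)),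
          (∀ i, g i ∈ Jetchev2008.modifiedSelmerGroup W K ι ((2 ^ M : ℕ) : ℤ) 1) ∧
          (∀ i, conjAct W τ ((2 ^ M : ℕ) : ℤ) (g i) = (-u) • g i) ∧
          (∀ b : Fin t → ℤ, (∀ σ ∈ torsionFixing (W.baseChange K) ((2 ^ (M + 1) : ℕ) : ℤ),
              h1Eval (W.baseChange K) ((2 ^ M : ℕ) : ℤ) (∑ i, b i • g i) σ = 0) → ∀ i, (2 : ℤ) ^ (M - a₀) ∣ b i) ∧
          (∀ y : galH1Torsion (W.baseChange K) ((2 ^ M : ℕ) : ℤ), y ∈ Jetchev2008.modifiedSelmerGroup W K ι ((2 ^ M : ℕ) : ℤ) 1 →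
            conjAct W τ ((2 ^ M : ℕ) : ℤ) y = (-u) • y →
            ∃ b : Fin t → ℤ, ∀ σ ∈ torsionFixing (W.baseChange K) ((2 ^ (M + 1) : ℕ) : ℤ),
              h1Eval (W.baseChange K) ((2 ^ M : ℕ) : ℤ) (((2 : ℤ) ^ a₀) • y - ∑ i, b i • g i) σ = 0) := by
  intro W _ _ hCM hred hsur K _ _ hK _ hH hodd hd3 htors hH2 Dt β ι _ hβ τ hτ1
  classical
  obtain ⟨m, sg, i₀, J, d, -, hsg, hframe⟩ := startFrameAtTwo_holds W hCM hred hsur K hK hH hodd hd3 htors hH2 Dt β ι hβ τ hτ1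
  refine ⟨J + 1 + d, fun M u hM hu ↦ ?_⟩
  obtain ⟨g, hgS, hgτ, -, hF3, hF4⟩ := hframe M hM
  -- the sign `ε = -u` and the `ε`-subfamily (indexed by `Fin S.card` through `S.orderIsoOfFin`)
  set ε : ℤ := -u with hε
  have hεu : ε = 1 ∨ ε = -1 := by rcases hu with rfl | rfl <;> simp [hε]
  have hεε : ε * ε = 1 := by rcases hεu with h | h <;> rw [h] <;> norm_num
  set S : Finset (Fin m) := Finset.univ.filter (fun i ↦ sg i = ε) with hS
  have hmemS : ∀ i, i ∈ S ↔ sg i = ε := fun i ↦ by rw [hS, Finset.mem_filter]; simp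
  have hle : torsionFixing (W.baseChange K) ((2 ^ (M + 1) : ℕ) : ℤ) ≤ torsionFixing (W.baseChange K) ((2 ^ M : ℕ) : ℤ) :=
    KolyvaginLowerBoundAtTwo.torsionFixing_le_of_dvd _ (RegularValueEngine.natCast_two_pow_dvd_succ M)
  refine ⟨S.card, fun j ↦ g ((S.orderIsoOfFin rfl j : S) : Fin m), fun j ↦ hgS _,
    fun j ↦ by rw [hgτ, (hmemS _).mp (S.orderIsoOfFin rfl j).2], ?_, ?_⟩
  · -- near-freeness: extend the coefficients by zero and use (F4)
    intro b' hb' j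
    have hsum := sum_extendByZero_smul S g b'
    have hres : ∀ ρ ∈ torsionFixing (W.baseChange K) ((2 ^ (M + 1) : ℕ) : ℤ),
        h1Eval (W.baseChange K) ((2 ^ M : ℕ) : ℤ)
          (∑ i, (if h : i ∈ S then b' ((S.orderIsoOfFin rfl).symm ⟨i, h⟩) else 0) • g i) ρ = 0 := fun ρ hρ ↦ by
      rw [hsum]; exact hb' ρ hρ
    have hdiv := hF4 _ hres ((S.orderIsoOfFin rfl j : S) : Fin m)
    have hj : (if h : ((S.orderIsoOfFin rfl j : S) : Fin m) ∈ S then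
        b' ((S.orderIsoOfFin rfl).symm ⟨((S.orderIsoOfFin rfl j : S) : Fin m), h⟩) else 0) = b' j := by
      rw [dif_pos (S.orderIsoOfFin rfl j).2]
      congr 1
      rw [OrderIso.symm_apply_eq]
    rw [hj] at hdiv
    exact (pow_dvd_pow 2 (by omega)).trans hdiv
  · -- spanning of the exact `ε`-classes, one more bit: symmetrise (F3) with `1 + ε τ`
    intro y hy hyτ
    obtain ⟨b, hb⟩ := hF3 y hy
    set x : galH1Torsion (W.baseChange K) ((2 ^ M : ℕ) : ℤ) := ((2 : ℤ) ^ J) • y - ∑ i, b i • g i with hx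
    -- `τ x` is a phantom too
    have hτx : ∀ ρ ∈ torsionFixing (W.baseChange K) ((2 ^ (M + 1) : ℕ) : ℤ),
        h1Eval (W.baseChange K) ((2 ^ M : ℕ) : ℤ) (conjAct W τ ((2 ^ M : ℕ) : ℤ) x) ρ = 0 := by
      have h := RegularValueEngine.forall_h1Eval_conjAct_eq W hK hτ1 (x := x) (x' := 0) (fun ρ hρ ↦ by
        rw [hb ρ hρ, h1Eval_zero _ _ (hle hρ)])
      intro ρ hρ
      rw [h ρ hρ, map_zero, h1Eval_zero _ _ (hle hρ)]
    -- `τ x = 2^J ε y - Σ bᵢ sgᵢ gᵢ`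
    have hτxeq : conjAct W τ ((2 ^ M : ℕ) : ℤ) x = ((2 : ℤ) ^ J) • (ε • y) - ∑ i, b i • (sg i • g i) := by
      rw [hx, map_sub, map_zsmul, hyτ, map_sum]
      congr 1
      exact Finset.sum_congr rfl fun i _ ↦ by rw [map_zsmul, hgτ]
    refine ⟨fun j ↦ (2 : ℤ) ^ (d + 1) * b ((S.orderIsoOfFin rfl j : S) : Fin m), fun ρ hρ ↦ ?_⟩
    have hre : ∑ i ∈ S, ((2 : ℤ) ^ (d + 1) * b i) • g i =
        ∑ j : Fin S.card, ((2 : ℤ) ^ (d + 1) * b ((S.orderIsoOfFin rfl j : S) : Fin m)) •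
          g ((S.orderIsoOfFin rfl j : S) : Fin m) :=
      sum_eq_sum_orderIsoOfFin S (fun i ↦ ((2 : ℤ) ^ (d + 1) * b i) • g i)
    have hkey : ((2 : ℤ) ^ (J + 1 + d)) • y -
        ∑ j : Fin S.card, ((2 : ℤ) ^ (d + 1) * b ((S.orderIsoOfFin rfl j : S) : Fin m)) •
          g ((S.orderIsoOfFin rfl j : S) : Fin m) =
        ((2 : ℤ) ^ d) • (x + ε • conjAct W τ ((2 ^ M : ℕ) : ℤ) x) := by
      rw [← hre, hτxeq, hx]
      exact symmetrised_frame_identity S g sg b hεε hmemS hsg J d y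
    rw [hkey, h1Eval_zsmul _ _ _ _ (hle hρ), h1Eval_add _ _ _ _ (hle hρ), h1Eval_zsmul _ _ _ _ (hle hρ), hb ρ hρ,
      hτx ρ hρ, zsmul_zero, add_zero, zsmul_zero]

end Summit.BirchSwinnertonDyer.BirchSwinnertonDyer.Theorems.KolyvaginAtTwo.RegularWalk

end
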